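import Summits.Schanuel.Schanuel.Theses.RootDecomp1H
import Summits.Schanuel.Schanuel.Theorems.RootDecomp1HProductCells
import Summits.Schanuel.Schanuel.Theorems.RootDecomp1HStarLocalisation
import Summits.Schanuel.Schanuel.Theorems.RoyCriterionRankOne
import Literature.NumberTheory.Transcendental.LindemannWeierstrassProofs


/-!
# RootDecomp1HMirror — ROUND 12 «MIRROR» of route `RootDecomp1H` (cell decomp-schanuel, lens 5, generation 12)

Target of the round: the route's symmetry crux `FirstFailureConjStable` (stmt-Schanuel-27286, rank 3: «a first failure of
Schanuel has conjugation-stable ℚ-span»), the one binder of the live `closes` (rev 15) that no earlier round touched.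

## The mirror ladder (§2).  Work with the Bays–Kirby predimension `δ(Λ) = td(Λ ∪ e^Λ) − dim Λ` of a finite-dimensional
`ℚ`-subspace `Λ ≤ ℂ` (`Literature…GammaFields`, `predim ⊥ Λ` over `ℂ_exp`; `SchanuelRank m ⟺ δ ≥ 0 in dimension m`,
`schanuelRank_iff_delta`) and complex conjugation `σ` (`conjQ`; `δ(σΛ) = δ(Λ)`, `delta_map_conjQ`).  The OBLIQUENESS of a
`ℚ`-free `n`-tuple `x` is `k(x) = dim(V + σV) − n`, `V = span x` (`k = 0` ⟺ conjugation-stable ⟺ the hypothesis 27286 asks).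
* `exists_conjStable_hyperplane`: a `σ`-stable subspace `W` of dimension `N+1` has a `σ`-stable hyperplane (`u = w ± σw`,
  `ψ = φ ± φ∘σ`, `P = ker ψ`).
* `ladder` (T_k): if Schanuel holds below `n`, `σ`-STABLE Schanuel holds in ranks `n … n+k−1`, and `x` is `ℚ`-free of rank `n`
  with `dim(V + σV) ≤ n + k`, then `n ≤ trdeg ℚ(x, eˣ)`.  (Submodularity `δ(V+σV) + δ(V ∩ σV) ≤ 2δ(V)`; `V ∩ σV` is a proper
  subspace, paid by the lower ranks; descend from `W = V + σV` along `σ`-stable hyperplanes, `δ` dropping `≤ 1` per step.)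
* `schanuel_iff_conjSchanuel`: `Schanuel ⟺ ∀ m, ConjSchanuelRank m` (the padding; known in the cell: lens-6 `ConjugationSymmetrisation`,
  lens-4 `KleinPolar`) — recorded as the EQUIV layer, not as a piece.
* `conjStable_sibling` (T₁, the load-bearing theorem): under the lower ranks, a first failure of obliqueness `≤ 1` has a
  conjugation-STABLE sibling first failure OF THE SAME RANK (a basis of a `σ`-stable hyperplane of `V + σV`).

## The re-cut (§3).  `FirstFailureNearStable` («a first failure has obliqueness ≤ 1», 27286's text with the conclusion weakened
to `∃ z, ∀ j, conj (x j) ∈ span (insert z (range x))`) and the support `ObliqueLift` (T₁ in item form, PROVED: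
`obliqueLift_holds`).  `closes₁₂` = the live deciding theorem with `h₁` re-cut (ten binders, pure logic; `closes₁₁` discharges
the support; `closes_live` recovers rev 15).  Exactness: 27286 → NearStable (`z := 0`); Schanuel → NearStable; NearStable ∧
ObliqueLift → a conjugation-stable first failure at every first-failure rank (`exists_conjStable_firstFailure`) — all that
`closes` ever used 27286 for.  What NearStable asserts beyond the tree: «no first failure is totally oblique of order ≥ 2»
(`schanuelRank_of_conj_window` shows the order-`k` layer is paid by `σ`-stable Schanuel in the window `n … n+k−1`; for `k = 1`
the window is the rank `n` itself, which the route's instrument + bridge supply inside the induction — that layer is free).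
Pointwise the piece is open from rank 2 on, like 27286 (rank ≤ 1 vacuous: §4, Hermite–Lindemann); the gain is structural.

## The Σ-design (§5, recorded not filed — item cap).  Index the induction by `σ`-STABLE rank: items `FinCSσ`, `BridgeCSσ`,
`StarLocalisationσ` = the live texts with «`∀ m < n, ConjSchanuelRank m`» as lower-rank hypothesis; then there is NO symmetry
binder at all (`closes_sigma`), the localisation reducing to the `σ`-presentability `SigmaPresentable` (Kirby–Ax under the
`σ`-lower ranks; `starLocalisationσ_of_sigmaPresentable` is the landed `c⋆`-minimisation verbatim).  `FinCSσ ⟹ FinCS`,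
`BridgeCSσ ⟹ BridgeCS`; `BridgeCSσ`, `StarLocalisationσ` necessary.

Nearest print: G. Diaz, «Utilisation de la conjugaison complexe dans l'étude de la transcendance de valeurs de la fonction
exponentielle usuelle», J. Théor. Nombres Bordeaux 16 (2004) [doi:10.5802/jtnb.459] §5 (Schanuel AT `σ`-stable pairs `(u, ū)`
⟹ statements on `|u|` — the converse direction of use); V. Mantova, «Involutions on Zilber fields» [arXiv:1109.6155]
(pseudo-exponential fields carry involutions with real-closed fixed field).  Predimension: [cite: BaysKirby2018ANT, §4].
Lens seat (planner role); defines the two proposed item texts and node-local notions only; 0 sorry; axioms of every theorem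
⊆ [propext, Classical.choice, Quot.sound] (g12/bc/axioms.txt).
-/


noncomputable section

set_option linter.dupNamespace false

namespace Summit.Schanuel.Schanuel.Theorems.RootDecomp1HMirror

open Complex Set
open Literature.NumberTheory.Transcendental
open Literature.NumberTheory.Transcendental.GammaField
open Summit.Schanuel.Schanuel.Theses.RootDecomp1H

variable {n : ℕ}

/-! ## §1 Tools: the predimension `δ(Λ) = δ(Λ/0)` of a finite-dimensional `ℚ`-subspace of `ℂ`, and complex conjugation -/

/-- Shorthand: `δ Λ := GammaField.predim ⊥ Λ = td(Λ ∪ e^Λ) − dim Λ` (Bays–Kirby Def. 4.1 over `ℂ_exp`). -/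
abbrev δ (Λ : Submodule ℚ ℂ) : ℤ := predim (⊥ : Submodule ℚ ℂ) Λ

/-- A finite-dimensional subspace is finitely generated over `0`. -/
theorem isFG_bot (Λ : Submodule ℚ ℂ) [FiniteDimensional ℚ Λ] : IsFG (⊥ : Submodule ℚ ℂ) Λ :=
  (isFG_iff_finite).2 inferInstance

/-- `ldim(Λ/0) = dim Λ`. -/
theorem ldim_bot_eq (Λ : Submodule ℚ ℂ) : ldim (⊥ : Submodule ℚ ℂ) Λ = Module.finrank ℚ Λ := by
  rw [ldim]
  have hinj : Function.Injective ((⊥ : Submodule ℚ ℂ).mkQ) := by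
    rw [← LinearMap.ker_eq_bot, Submodule.ker_mkQ]
  exact (Submodule.equivMapOfInjective _ hinj Λ).finrank_eq.symm

/-! ### Bridge `δ ↔ trdeg` (the lemmas of `MinimalCounterexampleInAcl/Negative/LocusMates.lean` §Bridge, re-proved here so that
this file does not depend on that file's import closure) -/

/-- `td(⟨x⟩_ℚ / 0)` is the rank of `x ∪ eˣ` in the algebraic matroid of `ℂ/ℚ`. [cite: BaysKirby2018ANT, Def. 4.1] -/
theorem td_bot_span_range (x : Fin n → ℂ) :
    td (⊥ : Submodule ℚ ℂ) (Submodule.span ℚ (range x)) = (algMatroid ℂ).eRk (range x ∪ range (cexp ∘ x)) := by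
  refine le_antisymm ?_ ?_
  · have hsub : gens (Submodule.span ℚ (range x)) ⊆ (algMatroid ℂ).closure (range x ∪ range (cexp ∘ x)) := by
      have h1 := gens_sup_span_subset_acl (⊥ : Submodule ℚ ℂ) (range x)
      rw [bot_sup_eq] at h1
      refine h1.trans (acl_subset_acl_of_subset ?_)
      rintro a (ha | ha | ha)
      · have ha' : a ∈ (algMatroid ℂ).closure (gens (⊥ : Submodule ℚ ℂ)) := subset_acl _ ha
        rw [ZilberHomogeneity.closure_gens_bot] at ha'
        exact (algMatroid ℂ).closure_subset_closure (empty_subset _) ha'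
      · exact subset_acl _ (Or.inl ha)
      · exact subset_acl _ (Or.inr (by rwa [range_comp]))
    rw [ZilberHomogeneity.td_bot, ← (algMatroid ℂ).eRk_closure_eq (range x ∪ range (cexp ∘ x))]
    exact (algMatroid ℂ).eRk_mono hsub
  · rw [ZilberHomogeneity.td_bot]
    refine (algMatroid ℂ).eRk_mono ?_
    rintro a (⟨i, rfl⟩ | ⟨i, rfl⟩)
    · exact mem_gens_of_mem (Submodule.subset_span ⟨i, rfl⟩)
    · exact exp_mem_gens (Submodule.subset_span ⟨i, rfl⟩)

/-- The rank of the finite set `x ∪ eˣ` is finite. -/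
theorem eRk_range_ne_top (x : Fin n → ℂ) : (algMatroid ℂ).eRk (range x ∪ range (cexp ∘ x)) ≠ ⊤ := by
  refine ne_top_of_le_ne_top ?_ ((algMatroid ℂ).eRk_le_encard _)
  exact ((finite_range x).union (finite_range _)).encard_lt_top.ne

/-- For `ℚ`-free `x`: `δ(⟨x⟩_ℚ/0) = rk(x ∪ eˣ) − n`. [cite: BaysKirby2018ANT, Def. 4.1] -/
theorem predim_bot_span_range {x : Fin n → ℂ} (hx : LinearIndependent ℚ x) :
    predim (⊥ : Submodule ℚ ℂ) (Submodule.span ℚ (range x)) =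
      (((algMatroid ℂ).eRk (range x ∪ range (cexp ∘ x))).toNat : ℤ) - n := by
  rw [predim_def, td_bot_span_range, ldim_bot_eq, finrank_span_eq_card hx, Fintype.card_fin]

/-- `m ≤ trdeg ℚ(x, eˣ)` iff `m ≤ rk(x ∪ eˣ)`. -/
theorem natCast_le_trdeg_iff (x : Fin n → ℂ) (m : ℕ) :
    (m : Cardinal) ≤ Algebra.trdeg ℚ ↥(IntermediateField.adjoin ℚ (range x ∪ range (cexp ∘ x))) ↔
      (m : ℕ∞) ≤ (algMatroid ℂ).eRk (range x ∪ range (cexp ∘ x)) :=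
  ⟨ZilberHomogeneity.natCast_le_eRk_of_le_trdeg, RootDecomp1HProductCells.le_trdeg_of_natCast_le_eRk⟩

/-- For `ℚ`-free `x`: `δ(⟨x⟩_ℚ/0) ≤ −1 ↔ trdeg ℚ(x, eˣ) < n`. -/
theorem predim_le_neg_one_iff {x : Fin n → ℂ} (hx : LinearIndependent ℚ x) :
    predim (⊥ : Submodule ℚ ℂ) (Submodule.span ℚ (range x)) ≤ -1 ↔
      Algebra.trdeg ℚ ↥(IntermediateField.adjoin ℚ (range x ∪ range (cexp ∘ x))) < (n : Cardinal) := by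
  rw [predim_bot_span_range hx, ← not_le, natCast_le_trdeg_iff]
  set r := (algMatroid ℂ).eRk (range x ∪ range (cexp ∘ x)) with hr
  have hr' : r = (r.toNat : ℕ∞) := (ENat.coe_toNat (eRk_range_ne_top x)).symm
  constructor
  · intro h hle
    rw [hr'] at hle
    have : n ≤ r.toNat := by exact_mod_cast hle
    omega
  · intro h
    have : ¬ n ≤ r.toNat := fun hle => h (by rw [hr']; exact_mod_cast hle)
    omega

/-- For `P ≤ W` finite-dimensional: `dim W = dim P + ldim(W/P)`. -/
theorem finrank_eq_add_ldim {P W : Submodule ℚ ℂ} [FiniteDimensional ℚ W] (h : P ≤ W) :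
    Module.finrank ℚ W = Module.finrank ℚ P + ldim P W := by
  haveI : FiniteDimensional ℚ P := Submodule.finiteDimensional_of_le h
  have := ldim_add (bot_le : (⊥ : Submodule ℚ ℂ) ≤ P) h (isFG_bot W)
  rwa [ldim_bot_eq, ldim_bot_eq] at this

/-- **Submodularity** of `δ` on finite-dimensional subspaces: `δ(X + Y) + δ(X ∩ Y) ≤ δ X + δ Y`
(Bays–Kirby Lemma 4.2 (2)+(3)). -/
theorem delta_submod (X Y : Submodule ℚ ℂ) [FiniteDimensional ℚ X] [FiniteDimensional ℚ Y] :
    δ (X ⊔ Y) + δ (X ⊓ Y) ≤ δ X + δ Y := by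
  haveI : FiniteDimensional ℚ ↥(X ⊔ Y) := Submodule.finiteDimensional_sup X Y
  have h1 := predim_add (bot_le : (⊥ : Submodule ℚ ℂ) ≤ Y) (le_sup_right : Y ≤ X ⊔ Y) (isFG_bot _)
  have h2 := predim_sup_le X Y ((isFG_bot X).of_le_left bot_le)
  have h3 := predim_add (bot_le : (⊥ : Submodule ℚ ℂ) ≤ X ⊓ Y) (inf_le_left : X ⊓ Y ≤ X) (isFG_bot _)
  simp only [δ]
  linarith

/-- Along `P ≤ W` of codimension one, `δ` drops by at most one: `δ W ≥ δ P − 1`. -/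
theorem delta_ge_of_codim_one {P W : Submodule ℚ ℂ} [FiniteDimensional ℚ W] (h : P ≤ W)
    (hcodim : Module.finrank ℚ W = Module.finrank ℚ P + 1) : δ P - 1 ≤ δ W := by
  have hadd := predim_add (bot_le : (⊥ : Submodule ℚ ℂ) ≤ P) h (isFG_bot W)
  have hl : ldim P W = 1 := by have := finrank_eq_add_ldim h; omega
  have hPW : -1 ≤ predim P W := by
    rw [predim_def, hl]; have := Int.natCast_nonneg (td P W).toNat; push_cast; linarith
  simp only [δ]; linarith

/-- A basis tuple of a finite-dimensional subspace of prescribed dimension. -/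
theorem exists_basis_tuple (Λ : Submodule ℚ ℂ) [FiniteDimensional ℚ Λ] {m : ℕ} (hm : Module.finrank ℚ Λ = m) :
    ∃ x : Fin m → ℂ, LinearIndependent ℚ x ∧ Submodule.span ℚ (range x) = Λ := by
  subst hm
  let b := Module.finBasis ℚ Λ
  refine ⟨fun i => (b i : ℂ), b.linearIndependent.map' Λ.subtype (Submodule.ker_subtype _), ?_⟩
  have h1 : Submodule.span ℚ (range fun i => (b i : ℂ)) = (Submodule.span ℚ (range b)).map Λ.subtype := by
    rw [Submodule.map_span, ← Set.range_comp]; rfl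
  rw [h1, b.span_eq, Submodule.map_top, Submodule.range_subtype]

/-- For `ℚ`-free `x`: `n ≤ trdeg ℚ(x, eˣ)` iff `0 ≤ δ(span x)`. -/
theorem le_trdeg_iff_delta_nonneg {x : Fin n → ℂ} (hx : LinearIndependent ℚ x) :
    (n : Cardinal) ≤ Algebra.trdeg ℚ ↥(IntermediateField.adjoin ℚ (range x ∪ range (cexp ∘ x))) ↔
      0 ≤ δ (Submodule.span ℚ (range x)) := by
  have h := predim_le_neg_one_iff hx
  simp only [δ]
  constructor
  · intro hle; by_contra hneg; exact absurd hle (not_le.2 (h.1 (by omega)))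
  · intro hnn; by_contra hlt; have := h.2 (not_le.1 hlt); omega

/-- `SchanuelRank m` in subspace form: `δ Λ ≥ 0` for every `m`-dimensional `Λ`. -/
theorem schanuelRank_iff_delta (m : ℕ) : SchanuelRank m ↔
    ∀ Λ : Submodule ℚ ℂ, FiniteDimensional ℚ Λ → Module.finrank ℚ Λ = m → 0 ≤ δ Λ := by
  constructor
  · intro h Λ _ hΛ
    obtain ⟨x, hx, rfl⟩ := exists_basis_tuple Λ hΛ
    exact (le_trdeg_iff_delta_nonneg hx).1 (h x hx)
  · intro h x hx
    haveI : FiniteDimensional ℚ ↥(Submodule.span ℚ (range x)) := FiniteDimensional.span_of_finite ℚ (finite_range x)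
    exact (le_trdeg_iff_delta_nonneg hx).2 (h _ inferInstance (by rw [finrank_span_eq_card hx, Fintype.card_fin]))

/-! ### Complex conjugation `σ` on `ℚ`-subspaces -/

/-- Complex conjugation as a `ℚ`-linear map. -/
def conjQ : ℂ →ₗ[ℚ] ℂ := (starRingEnd ℂ).toRatAlgHom.toLinearMap

/-- `conjQ z = conj z`. -/
@[simp] theorem conjQ_apply (z : ℂ) : conjQ z = (starRingEnd ℂ) z := rfl

/-- `conjQ` is an involution. -/
theorem conjQ_conjQ (z : ℂ) : conjQ (conjQ z) = z := by simp

/-- `conjQ` is injective. -/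
theorem conjQ_injective : Function.Injective conjQ := fun a b h => by
  simpa using congrArg conjQ h

/-- `σσΛ = Λ`. -/
theorem map_conjQ_map_conjQ (Λ : Submodule ℚ ℂ) : (Λ.map conjQ).map conjQ = Λ := by
  rw [← Submodule.map_comp]
  have : conjQ.comp conjQ = LinearMap.id := by ext z; simp
  rw [this, Submodule.map_id]

/-- `σ`-stability `σΛ ≤ Λ` of a subspace; for a tuple it says `conj (x j) ∈ span x` for all `j`. -/
theorem map_conjQ_span_le_iff (x : Fin n → ℂ) :
    (Submodule.span ℚ (range x)).map conjQ ≤ Submodule.span ℚ (range x) ↔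
      ∀ j, (starRingEnd ℂ) (x j) ∈ Submodule.span ℚ (range x) := by
  rw [Submodule.map_span, Submodule.span_le, ← Set.range_comp]
  exact ⟨fun h j => h ⟨j, rfl⟩, by rintro h _ ⟨j, rfl⟩; exact h j⟩

/-- `σ(span S) = span (σ S)`. -/
theorem map_conjQ_span (x : Fin n → ℂ) :
    (Submodule.span ℚ (range x)).map conjQ = Submodule.span ℚ (range (fun j => (starRingEnd ℂ) (x j))) := by
  rw [Submodule.map_span, ← Set.range_comp]; rfl

/-- If `σΛ ≤ Λ'` then `σΛ' ≥ Λ`… in the form used below: `σW ≤ W → W ≤ σW`. -/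
theorem le_map_conjQ_of_map_conjQ_le {W : Submodule ℚ ℂ} (h : W.map conjQ ≤ W) : W ≤ W.map conjQ := by
  have := Submodule.map_mono (f := conjQ) h
  rwa [map_conjQ_map_conjQ] at this

/-- `σΛ` has the same finite rank as `Λ`. -/
theorem finrank_map_conjQ (Λ : Submodule ℚ ℂ) [FiniteDimensional ℚ Λ] :
    Module.finrank ℚ ↥(Λ.map conjQ) = Module.finrank ℚ Λ :=
  (Submodule.equivMapOfInjective conjQ conjQ_injective Λ).finrank_eq.symm

/-- `σΛ` is finite-dimensional when `Λ` is. -/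
instance (Λ : Submodule ℚ ℂ) [FiniteDimensional ℚ Λ] : FiniteDimensional ℚ ↥(Λ.map conjQ) :=
  Module.Finite.map Λ conjQ

/-- `σ`-invariance of the transcendence degree of `ℚ(x, eˣ)`. -/
theorem trdeg_conj_eq (x : Fin n → ℂ) :
    Algebra.trdeg ℚ ↥(IntermediateField.adjoin ℚ (range (fun j => (starRingEnd ℂ) (x j)) ∪
        range (cexp ∘ fun j => (starRingEnd ℂ) (x j)))) =
      Algebra.trdeg ℚ ↥(IntermediateField.adjoin ℚ (range x ∪ range (cexp ∘ x))) := by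
  let σ : ℂ →ₐ[ℚ] ℂ := (starRingEnd ℂ).toRatAlgHom
  have σ_apply : ∀ z, σ z = (starRingEnd ℂ) z := fun z => rfl
  set Sx : Set ℂ := range x ∪ range (cexp ∘ x) with hSx
  have hset : (⇑σ) '' Sx = range (fun j => (starRingEnd ℂ) (x j)) ∪ range (cexp ∘ fun j => (starRingEnd ℂ) (x j)) := by
    rw [hSx, Set.image_union, ← Set.range_comp, ← Set.range_comp]
    have e1 : (⇑σ ∘ x) = fun j => (starRingEnd ℂ) (x j) := by funext j; simp [σ_apply]
    have e2 : (⇑σ ∘ (cexp ∘ x)) = cexp ∘ fun j => (starRingEnd ℂ) (x j) := by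
      funext j; simp [σ_apply, Complex.exp_conj]
    rw [e1, e2]
  have hmap : (IntermediateField.adjoin ℚ Sx).map σ = IntermediateField.adjoin ℚ
      (range (fun j => (starRingEnd ℂ) (x j)) ∪ range (cexp ∘ fun j => (starRingEnd ℂ) (x j))) := by
    rw [IntermediateField.adjoin_map, hset]
  exact (((IntermediateField.equivMap (IntermediateField.adjoin ℚ Sx) σ).trans
    (IntermediateField.equivOfEq hmap)).trdeg_eq).symm

/-- `σ`-invariance of `δ`: `δ(σΛ) = δ(Λ)`. -/
theorem delta_map_conjQ_span {m : ℕ} {x : Fin m → ℂ} (hx : LinearIndependent ℚ x) :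
    δ ((Submodule.span ℚ (range x)).map conjQ) = δ (Submodule.span ℚ (range x)) := by
  let xc : Fin m → ℂ := fun j => (starRingEnd ℂ) (x j)
  have hxc : LinearIndependent ℚ xc := hx.map' conjQ (LinearMap.ker_eq_bot.mpr conjQ_injective)
  rw [map_conjQ_span]
  show δ (Submodule.span ℚ (range xc)) = _
  simp only [δ, predim_bot_span_range hx, predim_bot_span_range hxc]
  congr 2
  -- equal ranks in the algebraic matroid, from equal transcendence degrees
  have key : ∀ k : ℕ, ((k : ℕ∞) ≤ (algMatroid ℂ).eRk (range xc ∪ range (cexp ∘ xc))) ↔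
      ((k : ℕ∞) ≤ (algMatroid ℂ).eRk (range x ∪ range (cexp ∘ x))) := by
    intro k
    rw [← natCast_le_trdeg_iff, ← natCast_le_trdeg_iff]
    show (k : Cardinal) ≤ Algebra.trdeg ℚ ↥(IntermediateField.adjoin ℚ (range (fun j => (starRingEnd ℂ) (x j)) ∪
        range (cexp ∘ fun j => (starRingEnd ℂ) (x j)))) ↔ _
    rw [trdeg_conj_eq]
  set a := (algMatroid ℂ).eRk (range xc ∪ range (cexp ∘ xc)) with ha
  set b := (algMatroid ℂ).eRk (range x ∪ range (cexp ∘ x)) with hb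
  have ha' : a = (a.toNat : ℕ∞) := (ENat.coe_toNat (eRk_range_ne_top xc)).symm
  have hb' : b = (b.toNat : ℕ∞) := (ENat.coe_toNat (eRk_range_ne_top x)).symm
  have h1 : (a.toNat : ℕ∞) ≤ b := (key a.toNat).1 ha'.symm.le
  have h2 : (b.toNat : ℕ∞) ≤ a := (key b.toNat).2 hb'.symm.le
  rw [hb'] at h1; rw [ha'] at h2
  have h1' : a.toNat ≤ b.toNat := by exact_mod_cast h1
  have h2' : b.toNat ≤ a.toNat := by exact_mod_cast h2
  omega



/-- `σ`-invariance of `δ`: `δ(σΛ) = δ(Λ)`. -/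
theorem delta_map_conjQ (Λ : Submodule ℚ ℂ) [FiniteDimensional ℚ Λ] : δ (Λ.map conjQ) = δ Λ := by
  obtain ⟨x, hx, hxΛ⟩ := exists_basis_tuple Λ rfl
  rw [← hxΛ]
  exact delta_map_conjQ_span hx

end Summit.Schanuel.Schanuel.Theorems.RootDecomp1HMirror
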